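import Literature.Analysis.FluidPDE.WeakHeatOperatorCutoff
import Literature.Analysis.FluidPDE.CaloricDualityTerms
import Literature.Analysis.FluidPDE.ParabolicHeatPotentials
import HarnessLib

/-!
# Cut-off fields with weak derivatives are heat potentials: the duality identity

Analysis/FluidPDE support file (everything proved) on the decomposition path of the named fact
`Literature.Analysis.FluidPDE.ParabolicSobolevHolderEmbedding` (Seregin 2014, §4.6, Prop. 6.8,
`W^{2,1}_{s,n}(Q) ⊂ C^μ(Q̄(1/2))`). Let `v` be a field on an open space–time region `Q` with a weak
time derivative `vₜ` (through its defining identities `ht`), a weak spatial gradient `G` and weak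
spatial gradients `H a` of the `G a` (accepted `HasWeakSpatialGradientOn`), let `φ` be a smooth
cut-off and

  `f = φ vₜ + (∂ₜφ) v - φ Σᵢ H eᵢ eᵢ - 2 Σᵢ (∂ᵢφ) G eᵢ - (Σᵢ ∂ᵢ∂ᵢφ) v = (∂ₜ - Δ)(φv)`

(`WeakHeatOperatorCutoff.lean`). This file proves the **duality identity**
(`integral_test_mul_cutoff_mul_inner_eq_integral_test_mul_heatPotential`): for every space–time
test function `g` whose time support ends at a time `T`, below which `tsupport φ` meets `Q` in a
compact set, and every constant vector `c`,

  `∫ g · φ⟪v, c⟫ = ∫ g · V_c`,  `V_c(z) = ∫ W₊(z - w) F(w) dw`,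

where `W₊ = heatKernelFwd 1` is the forward heat kernel and `F` is any integrable function with
bounded time support agreeing a.e. with `⟪f, c⟫` below a time `t_top ≥ T` (the zero extension of
`⟪f, c⟫`; the freedom is used downstream to take `F` measurable). Consequently `φ⟪v, c⟫ = V_c` a.e.
wherever such `g` are dense — the representation of `φv` as the heat potential of `(∂ₜ - Δ)(φv)`,
obtained without any uniqueness theorem for the heat equation.

The proof tests the weak derivatives against `φη`, `η = 𝒰[g] = heatDuhamelBack 1 g` the backward
caloric Duhamel integral of `g` (`HeatDuhamelBack.lean`: jointly smooth, `∂ₛη + Δη = -g`, `η = 0`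
after the time support of `g`), which is admissible because `tsupport φ ∩ tsupport η` is compact in
`Q` although neither factor is; `WeakHeatOperatorCutoff.integral_cutoff_mul_heat_mul_inner_eq` then
gives `∫ g φ ⟪v,c⟫ = ∫ η ⟪f, c⟫`, and since `η = W₋ ⋆ g` is the backward heat potential of `g`
(`heatDuhamelBack_one_eq_convolution_heatKernel`) Fubini (`integral_mul_convolution_comm`) turns
`∫ η F` into `∫ g (W₊ ⋆ F)`.

## References

* G. Seregin, *Lecture notes on regularity theory for the Navier–Stokes equations*, World
  Scientific (2014), §4.6 Prop. 6.8. [`Seregin2014`]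
* L. C. Evans, *Partial differential equations*, 2nd ed. (2010), §2.3.1 (Duhamel), §5.2.1.
  [`Evans2010`]
-/

noncomputable section

open MeasureTheory Set Function Filter TopologicalSpace ContinuousLinearMap
open scoped Topology RealInnerProductSpace Laplacian ContDiff Convolution

namespace Literature.Analysis.FluidPDE

variable {E : Type*} [NormedAddCommGroup E] [InnerProductSpace ℝ E] [FiniteDimensional ℝ E]
  [MeasurableSpace E] [BorelSpace E]

/-! ### The backward kernel of `𝒰` and the forward heat kernel -/

omit [FiniteDimensional ℝ E] [MeasurableSpace E] [BorelSpace E] in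
/-- The backward kernel of the Gauss–Weierstrass family is the time reflection of the forward
heat kernel: `backKernel G (p) = W₊(-p)` (`ν = 1`; the heat kernel is even in `x`). [folklore] -/
theorem backKernel_heatKernel_eq_heatKernelFwd_neg (p : ℝ × E) :
    backKernel (UnboundedOperators.heatKernel (E := E)) p = heatKernelFwd 1 (-p) := by
  by_cases hp : p.1 < 0
  · rw [show p = (p.1, p.2) from rfl, backKernel_of_neg _ hp, Prod.neg_mk,
      heatKernelFwd_of_pos 1 (show 0 < (-p.1, -p.2).1 by simpa using hp)]
    simp [UnboundedOperators.heatKernel, norm_neg]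
  · rw [show p = (p.1, p.2) from rfl, backKernel_of_nonneg _ (not_lt.1 hp), Prod.neg_mk,
      heatKernelFwd_of_nonpos 1 (show (-p.1, -p.2).1 ≤ 0 by simpa using not_lt.1 hp)]

/-- The reflected backward heat potential is the forward heat potential:
`∫ backKernel G (z - w) F(z) dz = ∫ W₊(w - z) F(z) dz`. [folklore] -/
theorem integral_backKernel_heatKernel_sub_mul (F : ℝ × E → ℝ) (w : ℝ × E) :
    ∫ z, backKernel (UnboundedOperators.heatKernel (E := E)) (z - w) * F z =
      ∫ z, heatKernelFwd 1 (w - z) * F z := by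
  refine integral_congr_ae (ae_of_all _ fun z => ?_)
  beta_reduce
  rw [backKernel_heatKernel_eq_heatKernelFwd_neg, neg_sub]

/-! ### The backward caloric Duhamel integral: support -/

/-- `η = 𝒰[g]` vanishes from the end `T` of the time support of `g` on: `η(s, x) = 0` for `s ≥ T`,
hence `tsupport η ⊆ (-∞, T] × E`. [folklore] -/
theorem tsupport_heatDuhamelBack_subset {g : ℝ → E → ℝ}
    (hg : IsSpaceTimeTestOn (⊤ : Opens (ℝ × E)) g) {a T : ℝ} (hgT : ∀ t, t ∉ Icc a T → g t = 0) :
    tsupport (uncurry (heatDuhamelBack 1 g)) ⊆ Iic T ×ˢ (univ : Set E) := by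
  refine closure_minimal (fun q hq => ?_) (isClosed_Iic.prod isClosed_univ)
  refine mem_prod.2 ⟨?_, mem_univ _⟩
  by_contra h
  exact hq (hg.heatDuhamelBack_eq_zero_of_le one_pos hgT (le_of_lt (not_le.1 h)) q.2)

/-! ### The duality pairing is absolutely convergent -/

/-- **Absolute convergence of the pairing** `F(z) K(z - w) g(w)`, `K = backKernel G`, for
integrable `F` with bounded time support and a space–time test function `g` (the tree's
`IsSliceBoundKernel.integrable_kernelPairing` for the reflected kernel with the bounded factor `g`
first, transported along the swap of the two variables). [folklore] -/
theorem integrable_pairing_backKernel_heatKernel {F : ℝ × E → ℝ} (hFi : Integrable F volume)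
    {a' b' : ℝ} (hFsupp : ∀ w, F w ≠ 0 → w.1 ∈ Icc a' b') {g : ℝ → E → ℝ}
    (hg : IsSpaceTimeTestOn (⊤ : Opens (ℝ × E)) g) :
    Integrable (fun p : (ℝ × E) × (ℝ × E) =>
      F p.1 * (backKernel (UnboundedOperators.heatKernel (E := E)) (p.1 - p.2) * uncurry g p.2))
      ((volume : Measure (ℝ × E)).prod volume) := by
  have hK := (isSliceBoundKernel_backKernel_heatKernel (E := E)).reflect
  obtain ⟨M, hM0, hM⟩ := hg.exists_norm_le
  obtain ⟨a, b, hab⟩ := hg.exists_time_support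
  have hgm : AEStronglyMeasurable (uncurry g) (volume : Measure (ℝ × E)) :=
    hg.contDiff.continuous.aestronglyMeasurable
  have hgM : ∀ᵐ z ∂(volume : Measure (ℝ × E)), |uncurry g z| ≤ M :=
    ae_of_all _ fun z => by rw [← Real.norm_eq_abs]; exact hM z.1 z.2
  have hgsupp : ∀ᵐ z ∂(volume : Measure (ℝ × E)), uncurry g z ≠ 0 → z.1 ∈ Icc a b :=
    ae_of_all _ fun z hz => by
      by_contra h
      exact hz (by simp only [uncurry]; rw [hab z.1 h]; rfl)
  have h := hK.integrable_kernelPairing hgm hM0 hgM hgsupp hFi hFsupp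
  -- swap the two variables
  have hswap : MeasurePreserving (Prod.swap : (ℝ × E) × (ℝ × E) → (ℝ × E) × (ℝ × E))
      ((volume : Measure (ℝ × E)).prod volume) ((volume : Measure (ℝ × E)).prod volume) :=
    Measure.measurePreserving_swap
  have h2 := (hswap.integrable_comp_emb
    (MeasurableEquiv.prodComm : (ℝ × E) × (ℝ × E) ≃ᵐ (ℝ × E) × (ℝ × E)).measurableEmbedding).2 h
  refine h2.congr (ae_of_all _ fun p => ?_)
  simp only [Function.comp_apply, Prod.fst_swap, Prod.snd_swap, neg_sub]
  ring

/-! ### The cut-off source paired with `η` -/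

section Source

variable {ι : Type*} [Fintype ι] {Q : Opens (ℝ × E)} {v vₜ : ℝ → E → E} {G : ℝ → E → E →L[ℝ] E}
  {H : ℝ → E → E →L[ℝ] E →L[ℝ] E} {φ η : ℝ → E → ℝ} {K : Set (ℝ × E)}

/-- **`∫ η ⟪f, c⟫` expanded**, `f = φvₜ + (∂ₜφ)v - φ Σᵢ Heᵢeᵢ - 2Σᵢ (∂ᵢφ) Geᵢ - (Σᵢ ∂ᵢ∂ᵢφ) v` the
cut-off source: for jointly smooth `φ`, `η` with `tsupport φ ∩ tsupport η ⊆ K ⊆ Q`, `K` compact, and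
locally integrable `v, vₜ, G, H eᵢ` on `Q`,
`∫ η ⟪f, c⟫ = ∫ φη⟪vₜ,c⟫ + ∫ (∂ₜφ)η⟪v,c⟫ - Σᵢ (∫ φη⟪Heᵢeᵢ,c⟫ + 2∫ (∂ᵢφ)η⟪Geᵢ,c⟫ + ∫ (∂ᵢ∂ᵢφ)η⟪v,c⟫)`
(linearity; every term is integrable). [folklore] -/
theorem integral_mul_inner_cutoffSource_eq (b : OrthonormalBasis ι ℝ E)
    (hv : LocallyIntegrableOn (uncurry v) (Q : Set (ℝ × E)) volume)
    (hvₜ : LocallyIntegrableOn (uncurry vₜ) (Q : Set (ℝ × E)) volume)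
    (hGi : LocallyIntegrableOn (uncurry G) (Q : Set (ℝ × E)) volume)
    (hHi : ∀ a : E, LocallyIntegrableOn (uncurry fun t x => H t x a) (Q : Set (ℝ × E)) volume)
    (hφ : ContDiff ℝ ∞ (uncurry φ)) (hη : ContDiff ℝ ∞ (uncurry η)) (hK : IsCompact K)
    (hKQ : K ⊆ (Q : Set (ℝ × E))) (h : tsupport (uncurry φ) ∩ tsupport (uncurry η) ⊆ K) (c : E) :
    ∫ z : ℝ × E, η z.1 z.2 *
        ⟪φ z.1 z.2 • vₜ z.1 z.2 + timeDeriv φ z.1 z.2 • v z.1 z.2 -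
          φ z.1 z.2 • ∑ i, H z.1 z.2 (b i) (b i) -
          (2 : ℝ) • ∑ i, fderiv ℝ (φ z.1) z.2 (b i) • G z.1 z.2 (b i) -
          (∑ i, fderiv ℝ (fun y => fderiv ℝ (φ z.1) y (b i)) z.2 (b i)) • v z.1 z.2, c⟫ =
      (∫ z : ℝ × E, φ z.1 z.2 * η z.1 z.2 * ⟪vₜ z.1 z.2, c⟫) +
        (∫ z : ℝ × E, timeDeriv φ z.1 z.2 * η z.1 z.2 * ⟪v z.1 z.2, c⟫) -
        ∑ i, ((∫ z : ℝ × E, φ z.1 z.2 * η z.1 z.2 * ⟪H z.1 z.2 (b i) (b i), c⟫) +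
          2 * (∫ z : ℝ × E, fderiv ℝ (φ z.1) z.2 (b i) * η z.1 z.2 * ⟪G z.1 z.2 (b i), c⟫) +
          ∫ z : ℝ × E, fderiv ℝ (fun y => fderiv ℝ (φ z.1) y (b i)) z.2 (b i) * η z.1 z.2 *
            ⟪v z.1 z.2, c⟫) := by
  -- continuity of the weights
  have hcφ := hφ.continuous
  have hcη := hη.continuous
  have hcφt := (contDiff_uncurry_timeDeriv_of_uncurry hφ).continuous
  have hcφi : ∀ i, Continuous fun z : ℝ × E => fderiv ℝ (φ z.1) z.2 (b i) := fun i =>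
    (contDiff_uncurry_fderiv_apply_of_uncurry hφ (b i)).continuous
  have hcφii : ∀ i, Continuous fun z : ℝ × E =>
      fderiv ℝ (fun y => fderiv ℝ (φ z.1) y (b i)) z.2 (b i) := fun i =>
    (contDiff_uncurry_fderiv_apply_of_uncurry
      (contDiff_uncurry_fderiv_apply_of_uncurry hφ (b i)) (b i)).continuous
  -- vanishing of the weights off `K`: every weight is (a derivative of `φ`) × `η`
  have hη0 : ∀ z ∉ tsupport (uncurry η), η z.1 z.2 = 0 := fun z hz =>
    show uncurry η z = 0 from image_eq_zero_of_notMem_tsupport hz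
  have hφ0 : ∀ z ∉ tsupport (uncurry φ), φ z.1 z.2 = 0 := fun z hz =>
    show uncurry φ z = 0 from image_eq_zero_of_notMem_tsupport hz
  have hφt0 : ∀ z ∉ tsupport (uncurry φ), timeDeriv φ z.1 z.2 = 0 := fun z hz =>
    IsSpaceTimeTestOn.timeDeriv_eq_zero_of_notMem hz
  have hφi0 : ∀ i, ∀ z ∉ tsupport (uncurry φ), fderiv ℝ (φ z.1) z.2 (b i) = 0 := fun i z hz => by
    rw [IsSpaceTimeTestOn.fderiv_slice_eq_zero_of_notMem hz]; rfl
  have hφii0 : ∀ i, ∀ z ∉ tsupport (uncurry φ),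
      fderiv ℝ (fun y => fderiv ℝ (φ z.1) y (b i)) z.2 (b i) = 0 := fun i z hz => by
    have h2 : z ∉ tsupport (uncurry fun t x => fderiv ℝ (φ t) x (b i)) := fun h' =>
      hz (tsupport_uncurry_fderiv_apply_subset φ (b i) h')
    have h3 := IsSpaceTimeTestOn.fderiv_slice_eq_zero_of_notMem
      (ψ := fun t x => fderiv ℝ (φ t) x (b i)) h2
    rw [h3]; rfl
  have hW : ∀ {w : ℝ × E → ℝ}, (∀ z ∉ tsupport (uncurry φ), w z = 0) →
      ∀ z ∉ K, w z * η z.1 z.2 = 0 := by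
    intro w hw z hz
    rcases notMem_tsupport_or_of_notMem h hz with h1 | h1
    · rw [hw z h1, zero_mul]
    · rw [hη0 z h1, mul_zero]
  -- integrability of the five kinds of terms
  have hI₁ : Integrable (fun z : ℝ × E => φ z.1 z.2 * η z.1 z.2 * ⟪vₜ z.1 z.2, c⟫) volume :=
    integrable_weight_mul_inner hvₜ (hcφ.mul hcη) hK hKQ (hW hφ0) c
  have hI₂ : Integrable (fun z : ℝ × E =>
      timeDeriv φ z.1 z.2 * η z.1 z.2 * ⟪v z.1 z.2, c⟫) volume :=
    integrable_weight_mul_inner hv (hcφt.mul hcη) hK hKQ (hW hφt0) c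
  have hI₃ : ∀ i, Integrable (fun z : ℝ × E =>
      φ z.1 z.2 * η z.1 z.2 * ⟪H z.1 z.2 (b i) (b i), c⟫) volume := fun i =>
    integrable_weight_mul_inner_apply (G := fun t x => H t x (b i)) (hHi (b i)) (hcφ.mul hcη) hK
      hKQ (hW hφ0) (b i) c
  have hI₄ : ∀ i, Integrable (fun z : ℝ × E =>
      fderiv ℝ (φ z.1) z.2 (b i) * η z.1 z.2 * ⟪G z.1 z.2 (b i), c⟫) volume := fun i =>
    integrable_weight_mul_inner_apply hGi ((hcφi i).mul hcη) hK hKQ (hW (hφi0 i)) (b i) c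
  have hI₅ : ∀ i, Integrable (fun z : ℝ × E =>
      fderiv ℝ (fun y => fderiv ℝ (φ z.1) y (b i)) z.2 (b i) * η z.1 z.2 * ⟪v z.1 z.2, c⟫)
      volume := fun i =>
    integrable_weight_mul_inner hv ((hcφii i).mul hcη) hK hKQ (hW (hφii0 i)) c
  -- the three sum terms, pointwise
  have e₃ : ∀ z : ℝ × E, η z.1 z.2 * (φ z.1 z.2 * ∑ i, ⟪H z.1 z.2 (b i) (b i), c⟫) =
      ∑ i, φ z.1 z.2 * η z.1 z.2 * ⟪H z.1 z.2 (b i) (b i), c⟫ := fun z => by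
    rw [Finset.mul_sum, Finset.mul_sum]
    exact Finset.sum_congr rfl fun i _ => by ring
  have e₄ : ∀ z : ℝ × E, η z.1 z.2 * (2 * ∑ i, fderiv ℝ (φ z.1) z.2 (b i) * ⟪G z.1 z.2 (b i), c⟫) =
      ∑ i, 2 * (fderiv ℝ (φ z.1) z.2 (b i) * η z.1 z.2 * ⟪G z.1 z.2 (b i), c⟫) := fun z => by
    rw [Finset.mul_sum, Finset.mul_sum]
    exact Finset.sum_congr rfl fun i _ => by ring
  have e₅ : ∀ z : ℝ × E, η z.1 z.2 *
      ((∑ i, fderiv ℝ (fun y => fderiv ℝ (φ z.1) y (b i)) z.2 (b i)) * ⟪v z.1 z.2, c⟫) =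
      ∑ i, fderiv ℝ (fun y => fderiv ℝ (φ z.1) y (b i)) z.2 (b i) * η z.1 z.2 * ⟪v z.1 z.2, c⟫ :=
    fun z => by
    rw [Finset.sum_mul, Finset.mul_sum]
    exact Finset.sum_congr rfl fun i _ => by ring
  -- integrability of the three sum terms
  have hJ₃ : Integrable (fun z : ℝ × E =>
      η z.1 z.2 * (φ z.1 z.2 * ∑ i, ⟪H z.1 z.2 (b i) (b i), c⟫)) volume :=
    (integrable_finsetSum _ fun i _ => hI₃ i).congr (ae_of_all _ fun z => by
      beta_reduce; exact (e₃ z).symm)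
  have hJ₄ : Integrable (fun z : ℝ × E =>
      η z.1 z.2 * (2 * ∑ i, fderiv ℝ (φ z.1) z.2 (b i) * ⟪G z.1 z.2 (b i), c⟫)) volume :=
    (integrable_finsetSum _ fun i _ => (hI₄ i).const_mul 2).congr (ae_of_all _ fun z => by
      beta_reduce; exact (e₄ z).symm)
  have hJ₅ : Integrable (fun z : ℝ × E => η z.1 z.2 *
      ((∑ i, fderiv ℝ (fun y => fderiv ℝ (φ z.1) y (b i)) z.2 (b i)) * ⟪v z.1 z.2, c⟫)) volume :=
    (integrable_finsetSum _ fun i _ => hI₅ i).congr (ae_of_all _ fun z => by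
      beta_reduce; exact (e₅ z).symm)
  -- pointwise expansion of the integrand, sums kept whole
  have hpt : ∀ z : ℝ × E, η z.1 z.2 *
      ⟪φ z.1 z.2 • vₜ z.1 z.2 + timeDeriv φ z.1 z.2 • v z.1 z.2 -
        φ z.1 z.2 • ∑ i, H z.1 z.2 (b i) (b i) -
        (2 : ℝ) • ∑ i, fderiv ℝ (φ z.1) z.2 (b i) • G z.1 z.2 (b i) -
        (∑ i, fderiv ℝ (fun y => fderiv ℝ (φ z.1) y (b i)) z.2 (b i)) • v z.1 z.2, c⟫ =
      φ z.1 z.2 * η z.1 z.2 * ⟪vₜ z.1 z.2, c⟫ +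
        timeDeriv φ z.1 z.2 * η z.1 z.2 * ⟪v z.1 z.2, c⟫ -
        (η z.1 z.2 * (φ z.1 z.2 * ∑ i, ⟪H z.1 z.2 (b i) (b i), c⟫) +
          η z.1 z.2 * (2 * ∑ i, fderiv ℝ (φ z.1) z.2 (b i) * ⟪G z.1 z.2 (b i), c⟫) +
          η z.1 z.2 *
            ((∑ i, fderiv ℝ (fun y => fderiv ℝ (φ z.1) y (b i)) z.2 (b i)) * ⟪v z.1 z.2, c⟫)) := by
    intro z
    simp only [inner_sub_left, inner_add_left, real_inner_smul_left, sum_inner]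
    ring
  -- integrate
  have hL : ∫ z : ℝ × E, η z.1 z.2 *
      ⟪φ z.1 z.2 • vₜ z.1 z.2 + timeDeriv φ z.1 z.2 • v z.1 z.2 -
        φ z.1 z.2 • ∑ i, H z.1 z.2 (b i) (b i) -
        (2 : ℝ) • ∑ i, fderiv ℝ (φ z.1) z.2 (b i) • G z.1 z.2 (b i) -
        (∑ i, fderiv ℝ (fun y => fderiv ℝ (φ z.1) y (b i)) z.2 (b i)) • v z.1 z.2, c⟫ =
      (∫ z : ℝ × E, φ z.1 z.2 * η z.1 z.2 * ⟪vₜ z.1 z.2, c⟫) +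
        (∫ z : ℝ × E, timeDeriv φ z.1 z.2 * η z.1 z.2 * ⟪v z.1 z.2, c⟫) -
        ((∫ z : ℝ × E, η z.1 z.2 * (φ z.1 z.2 * ∑ i, ⟪H z.1 z.2 (b i) (b i), c⟫)) +
          (∫ z : ℝ × E, η z.1 z.2 *
            (2 * ∑ i, fderiv ℝ (φ z.1) z.2 (b i) * ⟪G z.1 z.2 (b i), c⟫)) +
          ∫ z : ℝ × E, η z.1 z.2 *
            ((∑ i, fderiv ℝ (fun y => fderiv ℝ (φ z.1) y (b i)) z.2 (b i)) * ⟪v z.1 z.2, c⟫)) := by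
    have hI₁₂ : Integrable (fun z : ℝ × E => φ z.1 z.2 * η z.1 z.2 * ⟪vₜ z.1 z.2, c⟫ +
        timeDeriv φ z.1 z.2 * η z.1 z.2 * ⟪v z.1 z.2, c⟫) volume := hI₁.add hI₂
    have hJ₃₄ : Integrable (fun z : ℝ × E =>
        η z.1 z.2 * (φ z.1 z.2 * ∑ i, ⟪H z.1 z.2 (b i) (b i), c⟫) +
        η z.1 z.2 * (2 * ∑ i, fderiv ℝ (φ z.1) z.2 (b i) * ⟪G z.1 z.2 (b i), c⟫)) volume :=
      hJ₃.add hJ₄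
    have hJ₃₄₅ : Integrable (fun z : ℝ × E =>
        η z.1 z.2 * (φ z.1 z.2 * ∑ i, ⟪H z.1 z.2 (b i) (b i), c⟫) +
        η z.1 z.2 * (2 * ∑ i, fderiv ℝ (φ z.1) z.2 (b i) * ⟪G z.1 z.2 (b i), c⟫) +
        η z.1 z.2 * ((∑ i, fderiv ℝ (fun y => fderiv ℝ (φ z.1) y (b i)) z.2 (b i)) *
          ⟪v z.1 z.2, c⟫)) volume := hJ₃₄.add hJ₅
    rw [integral_congr_ae (ae_of_all _ hpt), integral_sub hI₁₂ hJ₃₄₅, integral_add hI₁ hI₂,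
      integral_add hJ₃₄ hJ₅, integral_add hJ₃ hJ₄]
  rw [hL]
  -- open the sums
  have hS₃ : ∫ z : ℝ × E, η z.1 z.2 * (φ z.1 z.2 * ∑ i, ⟪H z.1 z.2 (b i) (b i), c⟫) =
      ∑ i, ∫ z : ℝ × E, φ z.1 z.2 * η z.1 z.2 * ⟪H z.1 z.2 (b i) (b i), c⟫ := by
    rw [← integral_finsetSum _ fun i _ => hI₃ i]
    exact integral_congr_ae (ae_of_all _ fun z => by beta_reduce; exact e₃ z)
  have hS₄ : ∫ z : ℝ × E, η z.1 z.2 *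
      (2 * ∑ i, fderiv ℝ (φ z.1) z.2 (b i) * ⟪G z.1 z.2 (b i), c⟫) =
      ∑ i, 2 * ∫ z : ℝ × E, fderiv ℝ (φ z.1) z.2 (b i) * η z.1 z.2 * ⟪G z.1 z.2 (b i), c⟫ := by
    simp_rw [← integral_const_mul]
    rw [← integral_finsetSum _ fun i _ => (hI₄ i).const_mul 2]
    exact integral_congr_ae (ae_of_all _ fun z => by beta_reduce; exact e₄ z)
  have hS₅ : ∫ z : ℝ × E, η z.1 z.2 *
      ((∑ i, fderiv ℝ (fun y => fderiv ℝ (φ z.1) y (b i)) z.2 (b i)) * ⟪v z.1 z.2, c⟫) =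
      ∑ i, ∫ z : ℝ × E, fderiv ℝ (fun y => fderiv ℝ (φ z.1) y (b i)) z.2 (b i) * η z.1 z.2 *
        ⟪v z.1 z.2, c⟫ := by
    rw [← integral_finsetSum _ fun i _ => hI₅ i]
    exact integral_congr_ae (ae_of_all _ fun z => by beta_reduce; exact e₅ z)
  rw [hS₃, hS₄, hS₅, ← Finset.sum_add_distrib, ← Finset.sum_add_distrib]

end Source

/-! ### The duality identity -/

section Duality

variable {ι : Type*} [Fintype ι] {Q : Opens (ℝ × E)} {v vₜ : ℝ → E → E} {G : ℝ → E → E →L[ℝ] E}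
  {H : ℝ → E → E →L[ℝ] E →L[ℝ] E} {φ : ℝ → E → ℝ}

/-- **Cut-off fields with weak derivatives are heat potentials, by duality.** Let `v` have weak
time derivative `vₜ` (identities `ht`), weak spatial gradient `G` and weak spatial gradients `H a`
of the `G a` on `Q`; let `φ` be jointly smooth; let `g` be a space–time test function with
`g(t) = 0` for `t ∉ [a, T]`, and suppose `tsupport φ ∩ ((-∞, T] × E) ⊆ K ⊆ Q` with `K` compact. Let
`F` be integrable, vanishing outside a bounded time interval `[a', t_top]`, `T ≤ t_top`, and equal
a.e. on `{t < t_top}` to `⟪f, c⟫`, `f = φvₜ + (∂ₜφ)v - φ Σᵢ Heᵢeᵢ - 2Σᵢ (∂ᵢφ)Geᵢ - (Σᵢ∂ᵢ∂ᵢφ)v`.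
Then `∫ g · φ⟪v, c⟫ = ∫ g · V_c` with the forward heat potential
`V_c(z) = ∫ W₊(z - w) F(w) dw`, `W₊ = heatKernelFwd 1` (test with `φη`, `η = 𝒰[g]`:
`∫ gφ⟪v,c⟫ = -∫ φ(∂ₜη + Δη)⟪v,c⟫ = ∫ η⟪f,c⟫ = ∫ η F = ∫ F (W₋ ⋆ g) = ∫ g (W₊ ⋆ F)`; Evans, §2.3.1
and §5.2.1; the representation behind Seregin 2014, Prop. 6.8). [folklore] -/
theorem integral_test_mul_cutoff_mul_inner_eq_integral_test_mul_heatPotential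
    (b : OrthonormalBasis ι ℝ E) (hG : HasWeakSpatialGradientOn Q v G)
    (hH : ∀ a : E, HasWeakSpatialGradientOn Q (fun t x => G t x a) fun t x => H t x a)
    (hvₜ : LocallyIntegrableOn (uncurry vₜ) (Q : Set (ℝ × E)) volume)
    (ht : ∀ θ : ℝ → E → ℝ, IsSpaceTimeTestOn Q θ → ∀ w : E,
      ∫ t, ∫ x, timeDeriv θ t x * ⟪v t x, w⟫ = -∫ t, ∫ x, θ t x * ⟪vₜ t x, w⟫)
    (hφ : ContDiff ℝ ∞ (uncurry φ)) {g : ℝ → E → ℝ} (hg : IsSpaceTimeTestOn (⊤ : Opens (ℝ × E)) g)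
    {a T : ℝ} (hgT : ∀ t, t ∉ Icc a T → g t = 0) {K : Set (ℝ × E)} (hK : IsCompact K)
    (hKQ : K ⊆ (Q : Set (ℝ × E))) (hφK : tsupport (uncurry φ) ∩ Iic T ×ˢ (univ : Set E) ⊆ K)
    (c : E) {F : ℝ × E → ℝ} (hFi : Integrable F volume) {a' t_top : ℝ} (hT : T ≤ t_top)
    (hFsupp : ∀ w, F w ≠ 0 → w.1 ∈ Icc a' t_top)
    (hF : ∀ᵐ z ∂(volume : Measure (ℝ × E)), z.1 < t_top → F z =
      ⟪φ z.1 z.2 • vₜ z.1 z.2 + timeDeriv φ z.1 z.2 • v z.1 z.2 -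
        φ z.1 z.2 • ∑ i, H z.1 z.2 (b i) (b i) -
        (2 : ℝ) • ∑ i, fderiv ℝ (φ z.1) z.2 (b i) • G z.1 z.2 (b i) -
        (∑ i, fderiv ℝ (fun y => fderiv ℝ (φ z.1) y (b i)) z.2 (b i)) • v z.1 z.2, c⟫) :
    ∫ z : ℝ × E, g z.1 z.2 * (φ z.1 z.2 * ⟪v z.1 z.2, c⟫) =
      ∫ z : ℝ × E, g z.1 z.2 * ∫ w, heatKernelFwd 1 (z - w) * F w := by
  -- the co-test field `η = 𝒰[g]`
  set η : ℝ → E → ℝ := heatDuhamelBack 1 g with hη_def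
  have hη : ContDiff ℝ ∞ (uncurry η) := hg.contDiff_uncurry_heatDuhamelBack_infty one_pos
  have hηT : tsupport (uncurry η) ⊆ Iic T ×ˢ (univ : Set E) :=
    tsupport_heatDuhamelBack_subset hg hgT
  have hsupp : tsupport (uncurry φ) ∩ tsupport (uncurry η) ⊆ K :=
    (inter_subset_inter_right _ hηT).trans hφK
  have hv : LocallyIntegrableOn (uncurry v) (Q : Set (ℝ × E)) volume := hG.locallyIntegrableOn
  -- Step 1: `∫ g φ ⟪v,c⟫ = -∫ φ (∂ₜη + Δη) ⟪v,c⟫ = ∫ η ⟪f, c⟫`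
  have hA := integral_cutoff_mul_heat_mul_inner_eq b hG hH hvₜ ht hφ hη hK hKQ hsupp c
  have hS := integral_mul_inner_cutoffSource_eq b hv hvₜ hG.locallyIntegrableOn_grad
    (fun a => (hH a).locallyIntegrableOn_grad) hφ hη hK hKQ hsupp c
  have hheat : ∀ z : ℝ × E, timeDeriv η z.1 z.2 + Δ (η z.1) z.2 = -g z.1 z.2 := fun z =>
    timeDeriv_add_laplacian_heatDuhamelBack_one hg z.1 z.2
  have h1 : ∫ z : ℝ × E, g z.1 z.2 * (φ z.1 z.2 * ⟪v z.1 z.2, c⟫) =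
      -∫ z : ℝ × E, φ z.1 z.2 * (timeDeriv η z.1 z.2 + Δ (η z.1) z.2) * ⟪v z.1 z.2, c⟫ := by
    rw [← integral_neg]
    refine integral_congr_ae (ae_of_all _ fun z => ?_)
    beta_reduce
    rw [hheat z]; ring
  have h2 : ∫ z : ℝ × E, g z.1 z.2 * (φ z.1 z.2 * ⟪v z.1 z.2, c⟫) =
      ∫ z : ℝ × E, η z.1 z.2 *
        ⟪φ z.1 z.2 • vₜ z.1 z.2 + timeDeriv φ z.1 z.2 • v z.1 z.2 -
          φ z.1 z.2 • ∑ i, H z.1 z.2 (b i) (b i) -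
          (2 : ℝ) • ∑ i, fderiv ℝ (φ z.1) z.2 (b i) • G z.1 z.2 (b i) -
          (∑ i, fderiv ℝ (fun y => fderiv ℝ (φ z.1) y (b i)) z.2 (b i)) • v z.1 z.2, c⟫ := by
    rw [h1, hA, hS]; ring
  -- Step 2: `∫ η ⟪f, c⟫ = ∫ F η` (`η = 0` from `T` on, `F = ⟪f,c⟫` a.e. before `t_top ≥ T`)
  have hη0 : ∀ z : ℝ × E, T ≤ z.1 → η z.1 z.2 = 0 := fun z hz =>
    hg.heatDuhamelBack_eq_zero_of_le one_pos hgT hz z.2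
  have h3 : ∫ z : ℝ × E, η z.1 z.2 *
        ⟪φ z.1 z.2 • vₜ z.1 z.2 + timeDeriv φ z.1 z.2 • v z.1 z.2 -
          φ z.1 z.2 • ∑ i, H z.1 z.2 (b i) (b i) -
          (2 : ℝ) • ∑ i, fderiv ℝ (φ z.1) z.2 (b i) • G z.1 z.2 (b i) -
          (∑ i, fderiv ℝ (fun y => fderiv ℝ (φ z.1) y (b i)) z.2 (b i)) • v z.1 z.2, c⟫ =
      ∫ z : ℝ × E, F z * (backKernel (UnboundedOperators.heatKernel (E := E)) ⋆[lsmul ℝ ℝ,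
        (volume : Measure (ℝ × E))] uncurry g) z := by
    refine integral_congr_ae ?_
    filter_upwards [hF] with z hz
    have hconv : (backKernel (UnboundedOperators.heatKernel (E := E)) ⋆[lsmul ℝ ℝ,
        (volume : Measure (ℝ × E))] uncurry g) z = η z.1 z.2 := by
      rw [hη_def, heatDuhamelBack_one_eq_convolution_heatKernel hg z.1 z.2]
    rw [hconv]
    by_cases hz1 : z.1 < t_top
    · rw [← hz hz1, mul_comm]
    · rw [hη0 z (hT.trans (not_lt.1 hz1)), zero_mul, mul_zero]
  -- Step 3: Fubini, `∫ F (W₋ ⋆ g) = ∫ g (W₊ ⋆ F)`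
  have h4 := integral_mul_convolution_comm (integrable_pairing_backKernel_heatKernel hFi hFsupp hg)
  rw [h2, h3, h4]
  refine integral_congr_ae (ae_of_all _ fun w => ?_)
  simp only [uncurry]
  rw [convolution_reflect_lsmul_real_prod_apply, integral_backKernel_heatKernel_sub_mul]

end Duality

end Literature.Analysis.FluidPDE

end
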